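import Summits.BirchSwinnertonDyer.BirchSwinnertonDyer.Theorems.AlignedTransportAtTwoBSDOfMainConjectureRankOneAtTwoLeadingTermAlgebra
import Literature.NumberTheory.EllipticCurves.CanonicalPAdicHeightSqExistenceProofs
import Literature.NumberTheory.EllipticCurves.IwasawaLeadingTermProofs
import HarnessLib

/-!
# Route `AlignedTransportAtTwo`, crux C3′ `BSDOfMainConjectureRankOneAtTwo` (stmt-BirchSwinnertonDyer-23008), line `birth`, stub L —
# the crux BY NAME from the two `p = 2` analytic statements it reduces to (Schneider/BMS leading term at `2`, Perrin-Riou's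
# rank-one comparison at `2`; both OPEN at `2`, taken as INLINE hypotheses) and three published facts

HONEST FRAMING (cell `bsd-f1-sign2`, lead seat `bsd-line-att-p1` g2). BSD is NOT proved; C3′ is NOT closed (its two analytic inputs at
`p = 2` are open / not in print). THEOREMS ONLY; no definition; nothing asserted. This is the tree-side twin of the crux workfile
`Cruxes/BSDOfMainConjectureRankOneAtTwo/Lines/birth_typing_draft.lean` (where the two inputs are DRAFT `def`s for the typer): here they
are spelled out as hypotheses `hSchneider` / `hPR`, so that the day they are filed as named statements (typing asks T-23008-a/b, after the
refuter's normalisation audit H1–H6 of the line card) the closure of stub L is a one-line instantiation.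

* `hSchneider` — Perrin-Riou–Schneider / BMS Thm 1.7 AT `p = 2` over the `Σ²` height receptacle (`Dh.IsCanonicalSq`): the body of the tree
  fact `Schneider1985_order_charGenerator` with `p := 2` (printed for `p > 2`; OPEN at `2`).
* `hPR` — Perrin-Riou 1987's rank-one comparison AT `p = 2` on the cell: one rational `q` is both the `2`-adic BSD quotient
  `ϖ·[T¹]L₂(f,α)·log₂5 / ((1−α⁻¹)²·Reg₂(Dh))` and the archimedean one `L′(E,1)/(Ω_E·Reg_∞)` (printed for `p ∤ 2N`; the `2`-adic GZ leg
  is Disegni 2017 Thm B; OPEN at `2` as a statement).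
* PRINT: `rank_eq_analyticRank_of_analyticRank_le_one` (GZK), `nonempty_modularParametrizationData` (BCDT + Edixhoven),
  `mazurTate_sigmaSq_existsUnique_two` (Mazur–Tate 1991 / Silverman 2005: inhabits the `2`-adic height receptacle).
MECHANISM: GZK ⇒ `rank = 1`; the modular datum gives `f_E`, `ϖ > 0` with `ϖ·Ω_E = Ω⁺_f`; Mazur's main conjecture (a crux binder) at the
existing cyclotomic datum gives a generator `g` with `ι g = ϖ·L₂(f_E, α)`, so `ord_T g = ord_T L₂ = 1 = rank` and `hSchneider`(2) makes
`Reg₂(Dh) ≠ 0`; `hSchneider`(2)+(3) is the adapter's Schneider-shaped law (p594549) with `LOG = log₂5`, `B = (1−α⁻¹)²·Reg₂(Dh)`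
(`B ≠ 0` by `exists_unit_one_sub_unitRoot_inv`); `hPR` is the comparison law with the same `A, B`; the normalisation-free L3
`bsdp_of_leadingTerm_of_comparison` (p594193) concludes — `tors²`, `∏c_v`, `(1−α⁻¹)²`, `log₂5` and the height currency all cancel, so the
two hypotheses only need to be typed in the SAME currency. CONDITIONAL; `--supports stmt-BirchSwinnertonDyer-23008`; closes nothing.

References: [BalakrishnanMullerStein2015] Thm. 1.7; [Schneider1985]; [PerrinRiou1987]; [Disegni2017] Thm. B; [MazurTate1991] Thm. 3.1;
[Silverman2005DivPoly] §5; [GrossZagier1986]; [Kolyvagin1990]; [Miller2011LMS] Def. 1.1.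
-/

set_option autoImplicit false
-- the route's Theorems namespace repeats a component by design (summit = sub-problem, D-0017).
set_option linter.dupNamespace false

noncomputable section

open scoped Classical MatrixGroups ModularForm

open CongruenceSubgroup WeierstrassCurve Literature.NumberTheory.EllipticCurves
  Literature.NumberTheory.EllipticCurves.ModularForms Literature.NumberTheory.EllipticCurves.Greenberg1999
  Summit.BirchSwinnertonDyer.BirchSwinnertonDyer.Theorems.Rank1ResidualX1Defs
  Summit.BirchSwinnertonDyer.BirchSwinnertonDyer.Theorems.AlignedTransportAtTwoOrderTransfer
  Summit.BirchSwinnertonDyer.BirchSwinnertonDyer.Theorems.AlignedTransportAtTwoLeadingTermAlgebra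

namespace Summit.BirchSwinnertonDyer.BirchSwinnertonDyer.Theorems.AlignedTransportAtTwoLeadingTermClosure

/-- **C3′ from the Schneider/BMS leading term AT `2`, Perrin-Riou's comparison AT `2`, and three published facts (CONDITIONAL;
closes nothing).** See the module docstring for the reading of `hSchneider`, `hPR` (both OPEN at `p = 2`, inline) and the mechanism.
BSD is not proved; the crux stays open. [cite: BalakrishnanMullerStein2015, Thm. 1.7 (shape; printed for p > 2)]
[cite: PerrinRiou1987, Thm. (rank-one comparison; printed for p ∤ 2N)] [cite: Disegni2017, Thm. B] [cite: MazurTate1991, Thm. 3.1]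
[cite: Miller2011LMS, Def. 1.1] -/
theorem bsdOfMainConjectureRankOneAtTwo_of_leadingTermAtTwo_of_comparisonAtTwo
    (hSchneider :
      ∀ (W : WeierstrassCurve ℚ) [W.IsElliptic] [W.IsGloballyMinimal],
        W.HasGoodReductionAtPrime 2 → ¬ (2 : ℤ) ∣ W.frobeniusTrace 2 →
        ∀ (κ : ZpExtension ℚ 2) (γ : Field.absoluteGaloisGroup ℚ),
          κ.IsCyclotomic → κ.IsTopGenerator γ → IsCyclotomicVariable 2 γ →
        ∀ (D : W.SelmerDualData κ γ) [Module.Finite (IwasawaAlgebra 2) D.X], D.IsTorsion →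
        ∀ (fE : IwasawaAlgebra 2), D.charIdeal = Ideal.span {fE} →
        ∀ (Dh : PAdicHeightData W 2), Dh.IsCanonicalSq →
          (W.mordellWeilRank : ℕ∞) ≤ fE.order ∧
          (fE.order = W.mordellWeilRank ↔
            (SchneiderConjecture Dh ∧ Finite (AddCommGroup.primaryComponent W.sha 2))) ∧
          (SchneiderConjecture Dh → Finite (AddCommGroup.primaryComponent W.sha 2) →
            ∃ u : ℤ_[2]ˣ,
              ((PowerSeries.coeff W.mordellWeilRank fE : ℤ_[2]) : ℚ_[2]) *
                  padicLog 2 (cyclotomicGenerator 2) ^ W.mordellWeilRank * (W.torsionOrder : ℚ_[2]) ^ 2 =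
                ((u : ℤ_[2]) : ℚ_[2]) *
                  ((1 - (unitRoot W 2 : ℚ_[2])⁻¹) ^ 2 *
                    ((Nat.card (AddCommGroup.primaryComponent W.sha 2) : ℚ_[2]) * padicRegulator Dh * W.tamagawaProduct))))
    (hPR :
      ∀ (W : WeierstrassCurve ℚ) [W.IsElliptic] [W.IsGloballyMinimal],
        IsOrdinaryAt W 2 → (∀ x : ℚ, ¬ HasRationalTwoTorsionX W x) → W.analyticRank = 1 →
        ∀ [NeZero (W.conductorNorm ℤ)] (f : CuspForm (Gamma0 (W.conductorNorm ℤ)) 2), IsNewformOf W f →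
        ∀ (ϖ : ℚ), (ϖ : ℝ) * W.realPeriodRat = plusPeriod f →
        ∀ (Dh : PAdicHeightData W 2), Dh.IsCanonicalSq → SchneiderConjecture Dh →
          ∃ q : ℚ,
            (q : ℚ_[2]) * ((1 - (unitRoot W 2 : ℚ_[2])⁻¹) ^ 2 * padicRegulator Dh) =
                (ϖ : ℚ_[2]) * PowerSeries.coeff 1 (padicLFunction f (unitRoot W 2 : ℚ_[2])) *
                  padicLog 2 (cyclotomicGenerator 2) ∧
            (q : ℂ) * ((W.realPeriodRat : ℂ) * (W.regulator : ℂ)) = W.leadingLCoeff)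
    (hGZK : rank_eq_analyticRank_of_analyticRank_le_one) (hmod : nonempty_modularParametrizationData)
    (hMT : mazurTate_sigmaSq_existsUnique_two) :
    Summit.BirchSwinnertonDyer.BirchSwinnertonDyer.Theses.AlignedTransportAtTwo.BSDOfMainConjectureRankOneAtTwo := by
  intro W _ _ _ hord ht _ hr hL hMC
  haveI : NeZero (W.conductorNorm ℤ) := ⟨(W.conductorNorm_pos_holds).ne'⟩
  -- rank one (GZK)
  obtain ⟨hrank, -⟩ := hGZK W (le_of_eq hr)
  have hrank1 : W.mordellWeilRank = 1 := by rw [hrank, hr]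
  -- the conductor-level newform and its period ratio (modularity datum)
  obtain ⟨Dm⟩ := hmod W
  obtain ⟨ϖ, hϖpos, hϖ, -⟩ := Dm.exists_rat_mul_realPeriodRat_eq_plusPeriod
  have hf : IsNewformOf W Dm.f := Dm.isNewformOf
  have hL1 : (padicLFunction Dm.f (unitRoot W 2 : ℚ_[2])).order = 1 := hL Dm.f hf
  -- THE canonical `2`-adic height (Σ² receptacle)
  obtain ⟨Dh, hDh⟩ := exists_isCanonicalSq_two hMT W hord.1 hord.2
  -- (a) packaged as the adapter's Schneider-shaped law, with `LOG = log₂ 5`, `B = ε₂ · Reg₂(Dh)`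
  set ε : ℚ_[2] := (1 - (unitRoot W 2 : ℚ_[2])⁻¹) ^ 2 with hε
  have hS : ∀ (κ : ZpExtension ℚ 2) (γ : Field.absoluteGaloisGroup ℚ),
      κ.IsCyclotomic → κ.IsTopGenerator γ → IsCyclotomicVariable 2 γ →
      ∀ (D : W.SelmerDualData κ γ) [Module.Finite (IwasawaAlgebra 2) D.X], D.IsTorsion →
      ∀ fE : IwasawaAlgebra 2, D.charIdeal = Ideal.span {fE} → fE.order = (W.mordellWeilRank : ℕ∞) →
        ∃ u : ℤ_[2]ˣ, ((PowerSeries.coeff 1 fE : ℤ_[2]) : ℚ_[2]) * padicLog 2 (cyclotomicGenerator 2) *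
            (W.torsionOrder : ℚ_[2]) ^ 2 =
          ((u : ℤ_[2]) : ℚ_[2]) * (Nat.card (AddCommGroup.primaryComponent W.sha 2) : ℚ_[2]) * (ε * padicRegulator Dh) *
            (W.tamagawaProduct : ℚ_[2]) := by
    intro κ γ hκ hγ hγ' D _ hX fE hchar hordfE
    obtain ⟨-, hiff, h3⟩ := hSchneider W hord.1 hord.2 κ γ hκ hγ hγ' D hX fE hchar Dh hDh
    obtain ⟨hSch, hfin⟩ := hiff.mp hordfE
    obtain ⟨u, hu⟩ := h3 hSch hfin
    rw [hrank1, pow_one] at hu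
    exact ⟨u, by rw [hu]; ring⟩
  -- `Reg₂(Dh) ≠ 0` from (a)(2) at the main-conjecture generator
  have hSch : SchneiderConjecture Dh := by
    obtain ⟨κ, hκ, γ, hγ, hγ'⟩ := exists_isCyclotomic_isTopGenerator_isCyclotomicVariable_holds 2
    obtain ⟨D⟩ := W.nonempty_selmerDualData_holds κ γ hγ
    haveI : Module.Finite (IwasawaAlgebra 2) D.X := D.module_finite_holds hγ
    obtain ⟨hX, g, hchar, hι⟩ := hMC κ γ hκ hγ hγ' Dm.f hf ϖ hϖ D
    have hc : (ϖ : ℚ_[2]) ≠ 0 := by exact_mod_cast hϖpos.ne'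
    have hordg : g.order = (W.mordellWeilRank : ℕ∞) := by
      rw [← order_eq_order_of_iwasawaToPowerSeries_eq_C_mul 2 hc hι, hL1, hrank1]; rfl
    obtain ⟨-, hiff, -⟩ := hSchneider W hord.1 hord.2 κ γ hκ hγ hγ' D hX g hchar Dh hDh
    exact (hiff.mp hordg).1
  -- `B = ε₂ · Reg₂ ≠ 0`
  have hε0 : ε ≠ 0 := by
    obtain ⟨u₂, hu₂⟩ := exists_unit_one_sub_unitRoot_inv 2 W hord
    have hN : (W.reductionPointCount 2 : ℚ_[2]) ≠ 0 := by exact_mod_cast (W.reductionPointCount_pos 2).ne'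
    have hu1 : ‖((u₂ : ℤ_[2]) : ℚ_[2])‖ = 1 := PadicInt.isUnit_iff.mp u₂.isUnit
    have hu0 : ((u₂ : ℤ_[2]) : ℚ_[2]) ≠ 0 := by
      rw [← norm_pos_iff, hu1]; exact one_pos
    rw [hε, hu₂]
    exact pow_ne_zero 2 (mul_ne_zero hu0 hN)
  have hB : ε * padicRegulator Dh ≠ 0 := mul_ne_zero hε0 hSch
  -- the leading-term law (adapter) and the comparison law (b), same `A`, `B`
  have hLT := leadingTermLaw_of_schneiderShape_of_mazurMainConjecture W 2 hf hϖ hS hrank1 hL1 hMC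
  obtain ⟨q, hq1, hq2⟩ := hPR W hord ht hr Dm.f hf ϖ hϖ Dh hDh hSch
  refine bsdp_of_leadingTerm_of_comparison W 2 hGZK (le_of_eq hr) hB hLT ⟨q, ?_, hq2⟩
  rw [hq1]


end Summit.BirchSwinnertonDyer.BirchSwinnertonDyer.Theorems.AlignedTransportAtTwoLeadingTermClosure

end
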